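import Summits.FinalStateConjecture.FinalStateConjecture.Theses.CurvatureOrSymmetry

/-!
# Route CurvatureOrSymmetry — around the support item `VisibleIncompleteRay`

Support item `stmt-FinalStateConjecture-10213` (`VisibleIncompleteRay`) of route `CurvatureOrSymmetry`
for the Final State Conjecture asserts: a maximal vacuum Cauchy development of an admissible datum
whose future null infinity is incomplete (sojourn form) contains a future-incomplete null geodesic
`γ` which is VISIBLE — every `γ t`, `t ≥ 0`, lies in the chronological past of the nonnegative
image of some future-COMPLETE normalised null ray from the data hypersurface.

This file lands the parts of the item that are provable over the prelude today, as `--supports`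
lemmas, and records formally what the item asserts beyond them:

* `visibleIncompleteRay_of_noFourthExit` — the item is a corollary of the crux `NoFourthExit`
  (drop the curvature/symmetry alternative), as the route says.
* `exists_normalisedNullRay_of_not_hasCompleteNullInfinity` — the DEFINITION CHASE (card P2):
  incompleteness of `𝓘⁺` in the sojourn form unfolds to "for every compact `B₀ ⊆ X` there is
  `s > 0` such that outside every compact `B₁ ⊆ X` starts a future-INCOMPLETE normalised null ray
  spending affine time `< s` in `J⁺(ι B₀)`", and in particular
  (`exists_normalisedNullRay_bddAbove_of_not_hasCompleteNullInfinity`) some normalised null ray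
  from the data hypersurface is future incomplete.
* `exists_complete_normalisedNullRay_of_visibleIncompleteRay` — conversely, the item as typed
  yields, for every such development, a future-COMPLETE normalised null ray from `X` (visibility
  at `t = 0 ∈ dom`). Nothing in the hypotheses of the item supplies a complete ray (the negated
  sojourn clause only produces incomplete ones): this is the exterior-stability content
  (Klainerman–Nicolò 2003; Shen, arXiv:2211.15230) that the route's NOT DECOMPOSED YET paragraph
  names, and the reason the item is not closed here (see the item's evidence note).

Classical logic and unfolding of definitions only; no analysis happens in this file.
-/

-- every `Summit.FinalStateConjecture.FinalStateConjecture.…` name repeats the summit = sub-problem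
-- segment (D-0017 layout, CONVENTIONS §2; lakefile sets it for the library build, a standalone
-- elaboration of this file does not see that option); the duplicate is deliberate.
set_option linter.dupNamespace false

namespace Summit.FinalStateConjecture.FinalStateConjecture.Theorems

open Literature.Geometry.Lorentzian Set MeasureTheory
open scoped Manifold ContDiff ENNReal

open Summit.FinalStateConjecture.FinalStateConjecture.Theses.CurvatureOrSymmetry

/-- **`VisibleIncompleteRay` is a corollary of `NoFourthExit`** (route CurvatureOrSymmetry, support
item `stmt-FinalStateConjecture-10213` from crux `stmt-FinalStateConjecture-10210`): the crux
produces a visible future-incomplete null geodesic together with the curvature-or-symmetry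
alternative; forgetting the alternative gives the support statement verbatim. -/
theorem visibleIncompleteRay_of_noFourthExit (h : NoFourthExit) : VisibleIncompleteRay := by
  intro X _ _ _ _ _ _ D hD 𝒟 hmax hinc _
  obtain ⟨γ, dom, hγ, -⟩ := h X D hD 𝒟 hmax hinc
  exact ⟨γ, dom, hγ⟩

section DefinitionChase

variable {X : Type} [TopologicalSpace X] [ChartedSpace E3 X] [IsManifold (𝓡 3) ∞ X]
  [ConnectedSpace X] {D : InitialDataSet (𝓡 3) X}

/-- **Definition chase (card P2 of route CurvatureOrSymmetry).** If the Cauchy development `𝒟`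
does NOT have complete future null infinity in the sojourn form
(`Summit.FinalStateConjecture.HasCompleteNullInfinity`, i.e. Christodoulou's intrinsic notion as
rendered by `LorentzianMetric.HasCompleteFutureNullInfinity`), then for every compact `B₀ ⊆ X`
there is `s > 0` such that for every compact `B₁ ⊆ X` some normalised future null ray `γ` starting
at a point `p ∉ B₁` is future incomplete (affine domain bounded above) and spends affine time
`< s` in `J⁺(ι B₀)`. This is the literal negation of the definition (the Levi-Civita instance
binder of `HasCompleteNullInfinity` is propositional, so it is discharged by the ambient one).
Christodoulou, CQG 16 (1999) A23, pp. A26–A27; Dafermos–Rodnianski, arXiv:0811.0354, §2.6.2. -/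
theorem exists_normalisedNullRay_of_not_hasCompleteNullInfinity (𝒟 : CauchyDevelopment D)
    [𝒟.metric.HasLeviCivita] (h : ¬ Summit.FinalStateConjecture.HasCompleteNullInfinity 𝒟)
    {B₀ : Set X} (hB₀ : IsCompact B₀) :
    ∃ s : ℝ, 0 < s ∧ ∀ B₁ : Set X, IsCompact B₁ → ∃ p ∉ B₁, ∃ (γ : ℝ → 𝒟.carrier) (dom : Set ℝ),
      𝒟.metric.IsNormalisedNullRayFrom 𝒟.timeOrientation 𝒟.embed 𝒟.normal p γ dom ∧
        BddAbove dom ∧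
          sojournTime γ dom (𝒟.metric.causalFuture 𝒟.timeOrientation (𝒟.embed '' B₀)) <
            ENNReal.ofReal s := by
  have h' : ¬ 𝒟.metric.HasCompleteFutureNullInfinity 𝒟.timeOrientation 𝒟.embed 𝒟.normal :=
    fun hc ↦ h (@fun _ ↦ hc)
  unfold LorentzianMetric.HasCompleteFutureNullInfinity at h'
  push Not at h'
  obtain ⟨s, hs, hs'⟩ := h' B₀ hB₀
  refine ⟨s, hs, fun B₁ hB₁ ↦ ?_⟩
  obtain ⟨p, hp, γ, dom, hγ, hbdd, hsoj⟩ := hs' B₁ hB₁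
  exact ⟨p, hp, γ, dom, hγ, hbdd, hsoj⟩

/-- **An incomplete normalised null ray from incomplete null infinity.** If the Cauchy development
`𝒟` does not have complete future null infinity (sojourn form), then some normalised future null
ray from the data hypersurface — a maximal null geodesic `γ` with `γ 0 = ι p`, future-directed
null initial velocity normalised by `g(γ' 0, ν p) = -1` — has affine domain bounded above (take
`B₀ = B₁ = ∅` in `exists_normalisedNullRay_of_not_hasCompleteNullInfinity`). This is the half of
support item `VisibleIncompleteRay` that follows from the definitions alone.
Christodoulou, CQG 16 (1999) A23, p. A27. -/
theorem exists_normalisedNullRay_bddAbove_of_not_hasCompleteNullInfinity (𝒟 : CauchyDevelopment D)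
    [𝒟.metric.HasLeviCivita] (h : ¬ Summit.FinalStateConjecture.HasCompleteNullInfinity 𝒟) :
    ∃ (p : X) (γ : ℝ → 𝒟.carrier) (dom : Set ℝ),
      𝒟.metric.IsNormalisedNullRayFrom 𝒟.timeOrientation 𝒟.embed 𝒟.normal p γ dom ∧
        BddAbove dom := by
  obtain ⟨s, -, hs⟩ := exists_normalisedNullRay_of_not_hasCompleteNullInfinity 𝒟 h isCompact_empty
  obtain ⟨p, -, γ, dom, hγ, hbdd, -⟩ := hs ∅ isCompact_empty
  exact ⟨p, γ, dom, hγ, hbdd⟩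

end DefinitionChase

/-- **What `VisibleIncompleteRay` asserts beyond the definition chase.** The support item, as typed,
yields for every maximal vacuum Cauchy development of admissible data with incomplete `𝓘⁺` a
future-COMPLETE normalised null ray from the data hypersurface: the visible ray's parameter `0`
lies in its domain, and visibility at `t = 0` names a complete ray. No hypothesis of the item
produces a complete ray (the negated sojourn clause yields incomplete rays only,
`exists_normalisedNullRay_of_not_hasCompleteNullInfinity`); existence of complete outgoing rays
for asymptotically flat data is the content of exterior stability of Minkowski space
(Klainerman–Nicolò 2003, Thm. 1.1; Shen, arXiv:2211.15230), which is why the item is not settled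
by unfolding. -/
theorem exists_complete_normalisedNullRay_of_visibleIncompleteRay (h : VisibleIncompleteRay)
    (X : Type) [TopologicalSpace X] [ChartedSpace E3 X] [IsManifold (𝓡 3) ∞ X] [T2Space X]
    [SecondCountableTopology X] [ConnectedSpace X] {D : InitialDataSet (𝓡 3) X}
    (hD : D ∈ admissibleVacuumData X) (𝒟 : VacuumCauchyDevelopment D) (hmax : 𝒟.IsMaximal)
    (hinc : ¬ Summit.FinalStateConjecture.HasCompleteNullInfinity 𝒟.toCauchyDevelopment)
    [𝒟.metric.HasLeviCivita] :
    ∃ (p : X) (δ : ℝ → 𝒟.carrier) (s : Set ℝ),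
      𝒟.metric.IsNormalisedNullRayFrom 𝒟.timeOrientation 𝒟.embed 𝒟.normal p δ s ∧
        ¬ BddAbove s := by
  obtain ⟨γ, dom, -, h0, -, -, hvis⟩ := h X D hD 𝒟 hmax hinc
  obtain ⟨p, δ, s, hδ, hs, -⟩ := hvis 0 h0 le_rfl
  exact ⟨p, δ, s, hδ, hs⟩

end Summit.FinalStateConjecture.FinalStateConjecture.Theorems
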